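/-
Width seat `ym-line-cbag-p1-w3` (prover-ym-line-cbag-p1-w3-g3-0), route `ColdBoxAllGroups` (planner-of-record ym-idea-2), crux
`BoxFloorAllGroups` (stmt-QuantumFields-22254): the `SU(N)` instances of the route's proved cruxes and of the rung leaf `XiPow`.
-/
import Summits.QuantumFields.YangMills.Theorems.ColdBoxAllGroupsXiPow

/-!
# The `SU(N)` instances (`N ≥ 2`) of BOX_G, BULK_G and the rung leaf `XiPow` — in particular `SU(3)`

The route `ColdBoxAllGroups` proved, for EVERY compact simple `G` (tree sense `IsCompactSimpleLieGroup`) and every faithful unitary lattice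
representation, the cold-box Gaussian floor `BoxFloorAllGroups_proof` (stmt-QuantumFields-22254), the bulk transfer `BulkAllGroups_proof`
(stmt-QuantumFields-22255) and hence the rung leaf `xiPow_holds : XiPow` (`ξ(β) ≥ β^ε`).  The pre-birth tribunal dossier of the line recorded
the first witness OUTSIDE the known `SU(2)` regime — `BoxFloorAllGroups` specialised to `G = SU(3)`, `r =` the fundamental representation — as
PLAN-ONLY (BC5).  Since the tree proves that `SU(n)`, `n ≥ 2`, is a simple compact group (`isSimpleCompactGroup_specialUnitaryGroup_holds`) and
packages its fundamental representation as the `LatticeRep` `fundamentalLatticeRep n`, these witnesses are now one-line specialisations, recorded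
here by name:

* `boxTwoPointDomination_SU`, `bulkDominatesBox_SU`, `boxAndBulk_SU` — BOX / BULK (and both at one common pair of exponents) for the
  fundamental representation of `SU(N)`, `N ≥ 2`; `boxTwoPointDomination_SU3` — the dossier's BC5 witness `G = SU(3)`;
* `massGapPowerDecay_SU_rep` / `massGapPowerDecay_SU` / `massGapPowerDecay_SU3` — the rung statement `∃ ε > 0, MassGapPowerDecayOf 4 ρ ε` for every
  faithful unitary lattice representation of `SU(N)`, for its fundamental representation, and for `SU(3)` (the gauge group of QCD).

HONEST LABEL: `XiPow` is a RECORD-label rung of LADDER-YM (a power-rate UPPER bound `≤ β^{−ε}` on the lattice mass gap of the torus-limit states,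
i.e. `ξ ≥ β^ε`); it is NOT the Clay Yang–Mills mass gap and no summit statement is proved by anything here.  No sorry; no new definition;
standard axioms.
-/

set_option autoImplicit false

noncomputable section

namespace Summit.QuantumFields.YangMills.Theorems.ColdBoxAllGroups

open Literature.MathematicalPhysics.QuantumFieldTheory Literature.MathematicalPhysics.QuantumLattice
open Summit.QuantumFields.YangMills.Theorems.WeakCouplingRates

/-! `SU(N)`, `N ≥ 2`, is a compact simple Lie group in the tree sense, unconditionally: the Literature reduction
`isCompactSimpleLieGroup_specialUnitaryGroup` fed with the tree's proof `isSimpleCompactGroup_specialUnitaryGroup_holds` (the same term is the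
landed `FemtoCurvatureTwoPoint.Negative.UnfaithfulFalseSU.isCompactSimpleLieGroup_su`; it is inlined below to keep this file's imports inside
the route's cone). -/

/-- **BOX for `SU(N)`, `N ≥ 2`, fundamental representation**: there is a ceiling `θ₀ > 0` such that for all `0 < A < θ ≤ θ₀` some `c > 0`
has `BoxTwoPointDomination (fundamentalRep (Fin N)) A θ c` — the crux `BoxFloorAllGroups_proof` specialised. -/
theorem boxTwoPointDomination_SU {N : ℕ} (hN : 2 ≤ N) :
    ∃ θ₀ : ℝ, 0 < θ₀ ∧ ∀ A θ : ℝ, 0 < A → A < θ → θ ≤ θ₀ → ∃ c : ℝ, 0 < c ∧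
      BoxTwoPointDomination (G := Matrix.specialUnitaryGroup (Fin N) ℂ) (fundamentalRep (Fin N)) A θ c :=
  BoxFloorAllGroups_proof (Matrix.specialUnitaryGroup (Fin N) ℂ)
    (isCompactSimpleLieGroup_specialUnitaryGroup isSimpleCompactGroup_specialUnitaryGroup_holds hN) (fundamentalLatticeRep N)

/-- **BOX for `SU(3)`** (the tribunal dossier's BC5 witness outside the `SU(2)` regime, formerly plan-only `stub_boxFloor_SU3`): a ceiling
`θ₀ > 0` under which every window `0 < A < θ ≤ θ₀` carries a constant `c > 0` with `BoxTwoPointDomination (fundamentalRep (Fin 3)) A θ c`. -/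
theorem boxTwoPointDomination_SU3 :
    ∃ θ₀ : ℝ, 0 < θ₀ ∧ ∀ A θ : ℝ, 0 < A → A < θ → θ ≤ θ₀ → ∃ c : ℝ, 0 < c ∧
      BoxTwoPointDomination (G := Matrix.specialUnitaryGroup (Fin 3) ℂ) (fundamentalRep (Fin 3)) A θ c :=
  boxTwoPointDomination_SU (by norm_num)

/-- **BULK for `SU(N)`, `N ≥ 2`, fundamental representation**: under every ceiling `θ₀ > 0` there are exponents `0 < A < θ ≤ θ₀` with
`BulkDominatesBox (fundamentalRep (Fin N)) A θ` — the crux `BulkAllGroups_proof` specialised. -/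
theorem bulkDominatesBox_SU {N : ℕ} (hN : 2 ≤ N) :
    ∀ θ₀ : ℝ, 0 < θ₀ → ∃ A θ : ℝ, 0 < A ∧ A < θ ∧ θ ≤ θ₀ ∧
      BulkDominatesBox (G := Matrix.specialUnitaryGroup (Fin N) ℂ) (fundamentalRep (Fin N)) A θ :=
  BulkAllGroups_proof (Matrix.specialUnitaryGroup (Fin N) ℂ)
    (isCompactSimpleLieGroup_specialUnitaryGroup isSimpleCompactGroup_specialUnitaryGroup_holds hN) (fundamentalLatticeRep N)

/-- **BOX ∧ BULK at one common window, every compact simple `G`**: for every faithful unitary lattice representation `r` there are exponents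
`0 < A < θ` and a constant `c > 0` with BOTH `BoxTwoPointDomination r.ρ A θ c` and `BulkDominatesBox r.ρ A θ` (BULK's exponents chosen under
BOX's ceiling) — the joint hypothesis of the kernel glue `massGapPowerDecayOf_of_box`. -/
theorem boxAndBulk_allGroups (G : Type) [Group G] [TopologicalSpace G] [IsTopologicalGroup G] [CompactSpace G]
    [mG : MeasurableSpace G] [hBG : BorelSpace G] (hG : IsCompactSimpleLieGroup G) (r : LatticeRep G) :
    ∃ A θ c : ℝ, 0 < A ∧ A < θ ∧ 0 < c ∧ BoxTwoPointDomination r.ρ A θ c ∧ BulkDominatesBox r.ρ A θ := by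
  have hm : mG = borel G := @BorelSpace.measurable_eq G _ mG hBG
  subst hm
  letI : MeasurableSpace G := borel G
  haveI : BorelSpace G := ⟨rfl⟩
  have hbox : ∀ r : LatticeRep G, ∃ θ₀ : ℝ, 0 < θ₀ ∧ ∀ A θ : ℝ, 0 < A → A < θ → θ ≤ θ₀ → ∃ c : ℝ, 0 < c ∧
      BoxTwoPointDomination r.ρ A θ c := BoxFloorAllGroups_proof G hG
  have hbulk : ∀ r : LatticeRep G, ∀ θ₀ : ℝ, 0 < θ₀ → ∃ A θ : ℝ, 0 < A ∧ A < θ ∧ θ ≤ θ₀ ∧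
      BulkDominatesBox r.ρ A θ := BulkAllGroups_proof G hG
  obtain ⟨θ₀, hθ₀, hb⟩ := hbox r
  obtain ⟨A, θ, hA, hAθ, hθ, hk⟩ := hbulk r θ₀ hθ₀
  obtain ⟨c, hc, hB⟩ := hb A θ hA hAθ hθ
  exact ⟨A, θ, c, hA, hAθ, hc, hB, hk⟩

/-- **BOX ∧ BULK at one common window for `SU(N)`, `N ≥ 2`, fundamental representation.** -/
theorem boxAndBulk_SU {N : ℕ} (hN : 2 ≤ N) :
    ∃ A θ c : ℝ, 0 < A ∧ A < θ ∧ 0 < c ∧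
      BoxTwoPointDomination (G := Matrix.specialUnitaryGroup (Fin N) ℂ) (fundamentalRep (Fin N)) A θ c ∧
      BulkDominatesBox (G := Matrix.specialUnitaryGroup (Fin N) ℂ) (fundamentalRep (Fin N)) A θ :=
  boxAndBulk_allGroups (Matrix.specialUnitaryGroup (Fin N) ℂ)
    (isCompactSimpleLieGroup_specialUnitaryGroup isSimpleCompactGroup_specialUnitaryGroup_holds hN) (fundamentalLatticeRep N)

/-- **The rung for every faithful unitary lattice representation of `SU(N)`, `N ≥ 2`**: `∃ ε > 0, MassGapPowerDecayOf 4 r.ρ ε` (for `β ≥ β₀`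
every torus-limit state has RP-spectral mass gap `≤ β^{−ε}`) — `xiPow_holds` specialised.  NOT the Clay mass gap (RECORD-label rung). -/
theorem massGapPowerDecay_SU_rep {N : ℕ} (hN : 2 ≤ N) (r : LatticeRep (Matrix.specialUnitaryGroup (Fin N) ℂ)) :
    ∃ ε : ℝ, 0 < ε ∧ MassGapPowerDecayOf 4 r.ρ ε :=
  xiPow_holds (Matrix.specialUnitaryGroup (Fin N) ℂ)
    (isCompactSimpleLieGroup_specialUnitaryGroup isSimpleCompactGroup_specialUnitaryGroup_holds hN) r

/-- **The rung for `SU(N)`, `N ≥ 2`, fundamental representation**: `∃ ε > 0, MassGapPowerDecayOf 4 (fundamentalRep (Fin N)) ε` — the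
`N = 2` case is the leaf `XiPowSU2` (`xiPowSU2_holds`, proved earlier by route `WeakCouplingRates`).  NOT the Clay mass gap. -/
theorem massGapPowerDecay_SU {N : ℕ} (hN : 2 ≤ N) :
    ∃ ε : ℝ, 0 < ε ∧ MassGapPowerDecayOf 4 (G := Matrix.specialUnitaryGroup (Fin N) ℂ) (fundamentalRep (Fin N)) ε :=
  massGapPowerDecay_SU_rep hN (fundamentalLatticeRep N)

/-- **The rung for `SU(3)`** (four-dimensional lattice `SU(3)` Yang–Mills theory, Wilson action, fundamental representation): there is `ε > 0`
such that for `β ≥ β₀` every torus-limit state has RP-spectral mass gap `≤ β^{−ε}` in lattice units (`ξ(β) ≥ β^ε`).  An UPPER bound on the gap: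
NOT the Clay mass gap, and vacuously true in a massless phase. -/
theorem massGapPowerDecay_SU3 :
    ∃ ε : ℝ, 0 < ε ∧ MassGapPowerDecayOf 4 (G := Matrix.specialUnitaryGroup (Fin 3) ℂ) (fundamentalRep (Fin 3)) ε :=
  massGapPowerDecay_SU (by norm_num)

end Summit.QuantumFields.YangMills.Theorems.ColdBoxAllGroups

end
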